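import Literature.MathematicalPhysics.QuantumChemistry.WeinholdWilsonInequalities
import Summits.Ventures.CertifiedQuantumChemistry.Rows.SpinFlipQuotientLossless
import HarnessLib

/-!
# Ventures/CertifiedQuantumChemistry — Rows/OrbitalSignBlockingLossless.lean: the abelian point-group
# (sign-character) blocking of the sector DQG programme is LOSSLESS

HONEST FRAMING (verbatim): certified bounds for a stated model Hamiltonian in a stated basis; not a
claim about the real molecule beyond that model.

Seat rdm-B (generator B, FORMAT-qcl1 §8 `ORBSYM` hints), ROWS courtesy file (theorems only; no `def`, no
notation). `Literature/…/RDMSpatialSymmetryBlocks.lean` proved the STATE-level fact behind the §8 hints: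
for a vector with a definite character under the orbital sign operator `(−1)^{#(s ∩ S)}` every reduced
density matrix is blocked by character (Mazziotti 2007 §II.F eq. (95)). The SDP instances, however, are
programmes over ABSTRACT pairs `(γ, Γ)`; imposing the block structure there as extra CONSTRAINTS could in
principle raise the optimal value. This file proves it does not — the pair-level companion, in the
shape of `Rows/SpinFlipQuotientLossless.lean` (the `M = 0` flip quotient) and of the typer's
`RelaxationSymmetryAveraging.lean` (PERMUTATION groups; a sign character is not a relabelling):

* `posSemidef_diagMul` — a real diagonal congruence `M ↦ (c_p c_q M_pq) = D M Dᴴ` preserves `⪰ 0`;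
* `qMap_sign`, `gMap_sign` — Mazziotti's `Q`- and `G`-maps are COVARIANT under the sign congruence
  `γ_ik ↦ χ_i χ_k γ_ik`, `Γ_pq ↦ χ_{p₁} χ_{p₂} χ_{q₁} χ_{q₂} Γ_pq` (`χ = ±1`; the Kronecker deltas of
  eqs. (14)–(15) absorb the signs because `χ² = 1`);
* `isDQGFeasible_sign`, `isDQGFeasibleSector_sign` — hence the DQG-feasible set and the `S_z`-sector
  feasible set are INVARIANT under every sign congruence (traces, contraction, antisymmetry and the
  sector rows are unchanged);
* `rdmEnergy_sign` — the energy functional is invariant when the integral tables obey the SELECTION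
  RULE of spin-independent orbital signs `s_p = ±1`: `h_pq = 0` unless `s_p s_q = 1`, `g_pqrs = 0`
  unless `s_p s_r s_q s_s = 1` (abelian point group; `RDMSpatialSymmetryHamiltonian.lean`);
* **`exists_signSymmetric_of_isDQGFeasibleSector`** — LOSSLESS: under the selection rule every
  sector-feasible pair has a SIGN-SYMMETRIC sector-feasible partner (entries with an odd sign product
  vanish) with the SAME energy — its `ℤ₂` average, feasible by invariance + midpoint-convexity
  (`isDQGFeasibleSector_midpoint`, `rdmEnergy_midpoint` of `SpinFlipQuotientLossless.lean`);
* **`forall_isDQGFeasibleSector_iff_forall_signSymmetric`** — bound form: a real number lies below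
  the functional on ALL sector-feasible pairs iff it lies below it on the sign-symmetric ones, i.e.
  the symmetry-blocked instance (generator B `ORBSYM`) certifies exactly the same numbers (DQG rung;
  iterate over the generators of an abelian point group `ℤ₂^m` one character at a time).

Everything is PROVED (0 sorry, standard axioms); no definitions, no named facts. NOT here: the `T1`/`T2′`
rung (the three-index maps are covariant by the same mechanism; bookkeeping only), non-abelian point
groups, general one-body unitary covariance.

References: D. A. Mazziotti, in *Reduced-Density-Matrix Mechanics*, Adv. Chem. Phys. 134 (Wiley 2007)
ch. 3 §II.B eqs. (14)–(15), §II.F eq. (95) (spin and spatial symmetry adaptation); K. Gatermann,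
P. A. Parrilo, J. Pure Appl. Algebra 192 (2004) 95–128, §3 Thm 3.3 (invariant SDPs lose nothing under
restriction to the fixed-point subspace).

Tree (REUSED): `qMap_apply`, `gMap_apply` (`OnePositivityFromTwoPositivity`); `IsDQGFeasible`,
`IsDQGFeasibleSector`, `rdmEnergy` (`VariationalRDMRelaxation`); `isDQGFeasibleSector_midpoint`,
`rdmEnergy_midpoint` (`Rows/SpinFlipQuotientLossless`). Mathlib: `Matrix.PosSemidef.mul_mul_conjTranspose_same`,
`Matrix.diagonal_conjTranspose`, `Matrix.diagonal_mul`.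
-/

noncomputable section

namespace Summit.Ventures.CertifiedQuantumChemistry

open Matrix Finset
open Literature.MathematicalPhysics.QuantumLattice Literature.MathematicalPhysics.QuantumChemistry
open scoped ComplexOrder

section Abstract

variable {ι : Type*} [LinearOrder ι] [Fintype ι]

omit [LinearOrder ι] [Fintype ι] in
/-- A sign character squares to one. -/
theorem sign_mul_self {χ : ι → ℂ} (hχ : ∀ i, χ i = 1 ∨ χ i = -1) (i : ι) : χ i * χ i = 1 := by
  rcases hχ i with h | h <;> simp [h]

omit [LinearOrder ι] [Fintype ι] in
/-- A sign character is real. -/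
theorem star_sign {χ : ι → ℂ} (hχ : ∀ i, χ i = 1 ∨ χ i = -1) (i : ι) : star (χ i) = χ i := by
  rcases hχ i with h | h <;> simp [h]

omit [LinearOrder ι] in
/-- Diagonal congruence by a real diagonal preserves positive semidefiniteness:
`(c_p M_pq c_q)` is `D M Dᴴ` with `D = diag c`. -/
theorem posSemidef_diagMul {α : Type*} [Fintype α] [DecidableEq α] {M : Matrix α α ℂ}
    (hM : M.PosSemidef) (c : α → ℂ) (hc : ∀ p, star (c p) = c p) :
    (Matrix.of fun p q => c p * c q * M p q).PosSemidef := by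
  have h := hM.mul_mul_conjTranspose_same (Matrix.diagonal c)
  have heq : Matrix.diagonal c * M * (Matrix.diagonal c)ᴴ = Matrix.of fun p q => c p * c q * M p q := by
    ext p q
    rw [Matrix.diagonal_conjTranspose, Matrix.mul_apply]
    simp only [Matrix.diagonal_mul, Matrix.diagonal_apply, Pi.star_apply, hc, mul_ite, mul_zero,
      Finset.sum_ite_eq', Finset.mem_univ, if_true, Matrix.of_apply]
    ring
  rwa [heq] at h

omit [Fintype ι] in
/-- The `Q`-map is covariant under a sign congruence of the pair. -/
theorem qMap_sign {χ : ι → ℂ} (hχ : ∀ i, χ i = 1 ∨ χ i = -1) (γ : Matrix ι ι ℂ)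
    (Γ : Matrix (ι × ι) (ι × ι) ℂ) :
    qMap (Matrix.of fun i k => χ i * χ k * γ i k)
        (Matrix.of fun p q => χ p.1 * χ p.2 * (χ q.1 * χ q.2) * Γ p q) =
      Matrix.of fun p q => χ p.1 * χ p.2 * (χ q.1 * χ q.2) * qMap γ Γ p q := by
  ext ⟨i, j⟩ ⟨k, l⟩
  rw [Matrix.of_apply, qMap_apply, qMap_apply]
  simp only [Matrix.of_apply]
  rcases hχ i with hi | hi <;> rcases hχ j with hj | hj <;> rcases hχ k with hk | hk <;>
    rcases hχ l with hl | hl <;> simp only [hi, hj, hk, hl] <;> split_ifs <;> subst_vars <;>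
    first | ring1 | grind

omit [Fintype ι] in
/-- The `G`-map is covariant under a sign congruence of the pair. -/
theorem gMap_sign {χ : ι → ℂ} (hχ : ∀ i, χ i = 1 ∨ χ i = -1) (γ : Matrix ι ι ℂ)
    (Γ : Matrix (ι × ι) (ι × ι) ℂ) :
    gMap (Matrix.of fun i k => χ i * χ k * γ i k)
        (Matrix.of fun p q => χ p.1 * χ p.2 * (χ q.1 * χ q.2) * Γ p q) =
      Matrix.of fun p q => χ p.1 * χ p.2 * (χ q.1 * χ q.2) * gMap γ Γ p q := by
  ext ⟨i, j⟩ ⟨k, l⟩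
  rw [Matrix.of_apply, gMap_apply, gMap_apply]
  simp only [Matrix.of_apply]
  rcases hχ j with hj | hj <;> rcases hχ l with hl | hl <;> simp only [hj, hl] <;> split_ifs <;> subst_vars <;>
    first | ring1 | grind

/-- **DQG feasibility is invariant under a sign congruence** `γ_ik ↦ χ_i χ_k γ_ik`,
`Γ_pq ↦ χ_{p₁} χ_{p₂} χ_{q₁} χ_{q₂} Γ_pq` (`χ = ±1`): `D`, `Q`, `G` transform by the diagonal unitary
`diag(χ_{p₁} χ_{p₂})`, the linear rows are unchanged. -/
theorem isDQGFeasible_sign {χ : ι → ℂ} (hχ : ∀ i, χ i = 1 ∨ χ i = -1) {N : ℕ} {γ : Matrix ι ι ℂ}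
    {Γ : Matrix (ι × ι) (ι × ι) ℂ} (h : IsDQGFeasible N γ Γ) :
    IsDQGFeasible N (Matrix.of fun i k => χ i * χ k * γ i k)
      (Matrix.of fun p q => χ p.1 * χ p.2 * (χ q.1 * χ q.2) * Γ p q) := by
  classical
  have hs := sign_mul_self hχ
  have hst := star_sign hχ
  have hc2 : ∀ p : ι × ι, star (χ p.1 * χ p.2) = χ p.1 * χ p.2 := fun p => by
    rw [star_mul', hst, hst]
  -- the pair-index congruence as an instance of `posSemidef_diagMul`
  have hcongr : ∀ {M : Matrix (ι × ι) (ι × ι) ℂ}, M.PosSemidef →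
      (Matrix.of fun p q : ι × ι => χ p.1 * χ p.2 * (χ q.1 * χ q.2) * M p q).PosSemidef :=
    fun {M} hM => by
      have h' := posSemidef_diagMul hM (fun p : ι × ι => χ p.1 * χ p.2) hc2
      exact h'
  refine
    { herm_one := ?_, d_psd := hcongr h.d_psd, q_psd := ?_, g_psd := ?_, trace_one := ?_,
      contract := ?_, swap_fst := ?_, swap_snd := ?_ }
  · have hh := h.herm_one
    refine Matrix.IsHermitian.ext fun i k => ?_
    simp only [Matrix.of_apply, star_mul', hst]
    rw [hh.apply i k |>.symm]  -- star (γ k i) = γ i k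
    ring
  · rw [qMap_sign hχ]; exact hcongr h.q_psd
  · rw [gMap_sign hχ]; exact hcongr h.g_psd
  · simp only [Matrix.of_apply]
    rw [← h.trace_one]
    exact Finset.sum_congr rfl fun i _ => by rw [hs, one_mul]
  · intro i k
    simp only [Matrix.of_apply]
    calc ∑ j, χ i * χ j * (χ k * χ j) * Γ (i, j) (k, j)
        = χ i * χ k * ∑ j, Γ (i, j) (k, j) := by
          rw [Finset.mul_sum]
          refine Finset.sum_congr rfl fun j _ => ?_
          have := hs j
          linear_combination (χ i * χ k * Γ (i, j) (k, j)) * this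
      _ = ((N : ℂ) - 1) * (χ i * χ k * γ i k) := by rw [h.contract i k]; ring
  · intro i j q
    simp only [Matrix.of_apply, h.swap_fst i j q]
    ring
  · intro p k l
    simp only [Matrix.of_apply, h.swap_snd p k l]
    ring

end Abstract

/-! ### Sector rows, the energy functional, and losslessness of the sign blocking -/

section Sector

variable {Λ : Type*} [LinearOrder Λ] [Fintype Λ]

/-- Sector feasibility is invariant under a sign congruence by orbital signs `χ` on the spin
orbitals (`χ = ±1`; the `S_z` selection rule and the species traces are unchanged). -/
theorem isDQGFeasibleSector_sign {χ : Orb Λ → ℂ} (hχ : ∀ i, χ i = 1 ∨ χ i = -1) {a b : ℕ}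
    {γ : Matrix (Orb Λ) (Orb Λ) ℂ} {Γ : Matrix (Orb Λ × Orb Λ) (Orb Λ × Orb Λ) ℂ}
    (h : IsDQGFeasibleSector a b γ Γ) :
    IsDQGFeasibleSector a b (Matrix.of fun i k => χ i * χ k * γ i k)
      (Matrix.of fun p q => χ p.1 * χ p.2 * (χ q.1 * χ q.2) * Γ p q) := by
  have hs := sign_mul_self hχ
  have h4 : ∀ i j : Orb Λ, χ i * χ j * (χ i * χ j) = 1 := fun i j => by
    linear_combination (χ j * χ j) * hs i + hs j
  refine
    { dqg := isDQGFeasible_sign hχ h.dqg, spin_sel := ?_, trace_up := ?_, trace_down := ?_, trace_upUp := ?_,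
      trace_downDown := ?_, trace_upDown := ?_ }
  · intro p q σ τ hστ
    simp only [Matrix.of_apply, h.spin_sel p q σ τ hστ, mul_zero]
  · simp only [Matrix.of_apply, hs, one_mul]; exact h.trace_up
  · simp only [Matrix.of_apply, hs, one_mul]; exact h.trace_down
  · simp only [Matrix.of_apply, h4, one_mul]; exact h.trace_upUp
  · simp only [Matrix.of_apply, h4, one_mul]; exact h.trace_downDown
  · simp only [Matrix.of_apply, h4, one_mul]; exact h.trace_upDown

omit [LinearOrder Λ] in
/-- **The energy functional is invariant under the sign congruence when the integrals obey the
character selection rule**: orbital signs `s_p = ±1` (spin-independent, `χ_{pσ} = s_p`), `h_pq = 0`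
unless `s_p s_q = 1`, `g_pqrs = 0` unless `s_p s_r s_q s_s = 1` (abelian point group, Mazziotti 2007
§II.F eq. (95); cf. `RDMSpatialSymmetryHamiltonian.lean`). -/
theorem rdmEnergy_sign {s : Λ → ℂ} (h : Λ → Λ → ℂ) (g : Λ → Λ → Λ → Λ → ℂ) (hnuc : ℂ)
    (hh : ∀ p q, s p * s q ≠ 1 → h p q = 0)
    (hg : ∀ p q r t, s p * s r * (s q * s t) ≠ 1 → g p q r t = 0)
    (γ : Matrix (Orb Λ) (Orb Λ) ℂ) (Γ : Matrix (Orb Λ × Orb Λ) (Orb Λ × Orb Λ) ℂ) :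
    rdmEnergy h g hnuc (Matrix.of fun i k => s (ofLex i).1 * s (ofLex k).1 * γ i k)
        (Matrix.of fun p q => s (ofLex p.1).1 * s (ofLex p.2).1 *
          (s (ofLex q.1).1 * s (ofLex q.2).1) * Γ p q) =
      rdmEnergy h g hnuc γ Γ := by
  have h1 : ∀ p q : Λ, h p q * ∑ σ : Fin 2,
      (Matrix.of fun i k : Orb Λ => s (ofLex i).1 * s (ofLex k).1 * γ i k) (orb p σ) (orb q σ) =
        h p q * ∑ σ : Fin 2, γ (orb p σ) (orb q σ) := by
    intro p q
    simp only [Matrix.of_apply, orb, ofLex_toLex, ← Finset.mul_sum]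
    by_cases hpq : s p * s q = 1
    · rw [hpq, one_mul]
    · rw [hh p q hpq, zero_mul, zero_mul]
  have h2 : ∀ p q r t : Λ, g p q r t * ∑ σ : Fin 2, ∑ τ : Fin 2,
      (Matrix.of fun P Q : Orb Λ × Orb Λ => s (ofLex P.1).1 * s (ofLex P.2).1 *
        (s (ofLex Q.1).1 * s (ofLex Q.2).1) * Γ P Q) (orb p σ, orb r τ) (orb q σ, orb t τ) =
        g p q r t * ∑ σ : Fin 2, ∑ τ : Fin 2, Γ (orb p σ, orb r τ) (orb q σ, orb t τ) := by
    intro p q r t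
    simp only [Matrix.of_apply, orb, ofLex_toLex, ← Finset.mul_sum]
    by_cases hc : s p * s r * (s q * s t) = 1
    · rw [hc, one_mul]
    · rw [hg p q r t hc, zero_mul, zero_mul]
  unfold rdmEnergy
  simp only [h1, h2]

/-- **LOSSLESS sign blocking, DQG rung.** If the integral tables obey the selection rule of the
orbital signs `s = ±1`, every sector-feasible pair has a SIGN-SYMMETRIC sector-feasible partner with
the same energy: its `ℤ₂` average `(½(γ + s·γ·s), ½(Γ + (s⊗s)·Γ·(s⊗s)))`, whose entries with an odd
sign product vanish — i.e. imposing the §8 ORBSYM block structure as CONSTRAINTS loses nothing. -/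
theorem exists_signSymmetric_of_isDQGFeasibleSector {s : Λ → ℂ} (hs : ∀ p, s p = 1 ∨ s p = -1)
    (h : Λ → Λ → ℂ) (g : Λ → Λ → Λ → Λ → ℂ) (hnuc : ℂ)
    (hh : ∀ p q, s p * s q ≠ 1 → h p q = 0)
    (hg : ∀ p q r t, s p * s r * (s q * s t) ≠ 1 → g p q r t = 0) {a b : ℕ}
    {γ : Matrix (Orb Λ) (Orb Λ) ℂ} {Γ : Matrix (Orb Λ × Orb Λ) (Orb Λ × Orb Λ) ℂ}
    (hf : IsDQGFeasibleSector a b γ Γ) :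
    ∃ (γ' : Matrix (Orb Λ) (Orb Λ) ℂ) (Γ' : Matrix (Orb Λ × Orb Λ) (Orb Λ × Orb Λ) ℂ),
      IsDQGFeasibleSector a b γ' Γ' ∧
      (∀ i k, s (ofLex i).1 * s (ofLex k).1 ≠ 1 → γ' i k = 0) ∧
      (∀ p q : Orb Λ × Orb Λ, s (ofLex p.1).1 * s (ofLex p.2).1 * (s (ofLex q.1).1 * s (ofLex q.2).1) ≠ 1 →
        Γ' p q = 0) ∧
      rdmEnergy h g hnuc γ' Γ' = rdmEnergy h g hnuc γ Γ := by
  have hχ : ∀ i : Orb Λ, s (ofLex i).1 = 1 ∨ s (ofLex i).1 = -1 := fun i => hs _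
  -- a sign product which is not `1` is `-1`
  have hpm : ∀ {z : ℂ}, (z = 1 ∨ z = -1) → z ≠ 1 → z = -1 := fun hz hz1 => hz.resolve_left hz1
  have hprod2 : ∀ i k : Orb Λ, s (ofLex i).1 * s (ofLex k).1 = 1 ∨ s (ofLex i).1 * s (ofLex k).1 = -1 :=
    fun i k => by
      rcases hχ i with h1 | h1 <;> rcases hχ k with h2 | h2 <;> simp [h1, h2]
  have hprod4 : ∀ p q : Orb Λ × Orb Λ,
      s (ofLex p.1).1 * s (ofLex p.2).1 * (s (ofLex q.1).1 * s (ofLex q.2).1) = 1 ∨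
        s (ofLex p.1).1 * s (ofLex p.2).1 * (s (ofLex q.1).1 * s (ofLex q.2).1) = -1 := fun p q => by
    rcases hprod2 p.1 p.2 with h1 | h1 <;> rcases hprod2 q.1 q.2 with h2 | h2 <;> simp [h1, h2]
  refine ⟨(1 / 2 : ℂ) • (γ + Matrix.of fun i k => s (ofLex i).1 * s (ofLex k).1 * γ i k),
    (1 / 2 : ℂ) • (Γ + Matrix.of fun p q => s (ofLex p.1).1 * s (ofLex p.2).1 *
      (s (ofLex q.1).1 * s (ofLex q.2).1) * Γ p q),
    isDQGFeasibleSector_midpoint hf (isDQGFeasibleSector_sign hχ hf), fun i k hik => ?_,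
    fun p q hpq => ?_, ?_⟩
  · simp only [Matrix.smul_apply, Matrix.add_apply, Matrix.of_apply, hpm (hprod2 i k) hik]
    ring
  · simp only [Matrix.smul_apply, Matrix.add_apply, Matrix.of_apply, hpm (hprod4 p q) hpq]
    ring
  · rw [rdmEnergy_midpoint, rdmEnergy_sign h g hnuc hh hg]
    ring

/-- **The sign-blocked programme certifies the same numbers** (bound form, DQG rung): with integral
tables obeying the selection rule, a real number lies below the energy functional on ALL
sector-feasible pairs iff it lies below it on the SIGN-SYMMETRIC ones. -/
theorem forall_isDQGFeasibleSector_iff_forall_signSymmetric {s : Λ → ℂ}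
    (hs : ∀ p, s p = 1 ∨ s p = -1) (h : Λ → Λ → ℂ) (g : Λ → Λ → Λ → Λ → ℂ) (hnuc : ℂ)
    (hh : ∀ p q, s p * s q ≠ 1 → h p q = 0)
    (hg : ∀ p q r t, s p * s r * (s q * s t) ≠ 1 → g p q r t = 0) (a b : ℕ) (c : ℝ) :
    (∀ γ Γ, IsDQGFeasibleSector a b γ Γ → c ≤ (rdmEnergy h g hnuc γ Γ).re) ↔
      ∀ γ Γ, IsDQGFeasibleSector a b γ Γ →
        (∀ i k, s (ofLex i).1 * s (ofLex k).1 ≠ 1 → γ i k = 0) →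
        (∀ p q : Orb Λ × Orb Λ,
          s (ofLex p.1).1 * s (ofLex p.2).1 * (s (ofLex q.1).1 * s (ofLex q.2).1) ≠ 1 → Γ p q = 0) →
        c ≤ (rdmEnergy h g hnuc γ Γ).re := by
  refine ⟨fun hc γ Γ hf _ _ => hc γ Γ hf, fun hc γ Γ hf => ?_⟩
  obtain ⟨γ', Γ', hf', hγ', hΓ', hE⟩ := exists_signSymmetric_of_isDQGFeasibleSector hs h g hnuc hh hg hf
  rw [← hE]
  exact hc γ' Γ' hf' hγ' hΓ'

end Sector


end Summit.Ventures.CertifiedQuantumChemistry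

end
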